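import Mathlib
import Summits.Ventures.PercRepro2.SepSplitLocus

/-!
# Gluing at a general separator, VII: the two sides exchanged (blind cell PercRepro2, mine-2 g48,
2026-08-29; `conjectures/MINE-2.md` M2-98)

When no mark at all is a separator vertex, a split of the marks may be read from either side
(`SepSplit.swap`): the far side becomes the root side and the side assignment is complemented.  The
rule and the equality locus then come in a second form (`typedCount_nonneg_of_sepSplit_realised_swap`,
`typedCount_eq_zero_iff_of_sepSplit_swap`): it suffices that the realised orbit sums of the glued
counts of the OTHER side be nonnegative — whichever side carries the provable statement.  Own work;
standard axioms.
-/

namespace Summit.Ventures.PercRepro2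

open UnionCluster

namespace CovForm

namespace RootBridge

open OneTyped TypedA3 Untouched TypedFactor Separated

section Swap

open Classical

variable {V : Type*} {E : Type*} {ι : Type*} [Fintype E] [DecidableEq E] [Fintype ι]
  [DecidableEq ι] {R : Type*} [Field R] [LinearOrder R] [IsStrictOrderedRing R]
variable (ends : E → Sym2 V) (mk : Fin 5 → V) (σ : ι → V)

omit [Fintype E] [Fintype ι] [DecidableEq ι] [LinearOrder R] [IsStrictOrderedRing R] in
/-- **The sides exchanged**: when the root-side marks are not separator vertices either, the split
with the complemented side assignment and the sides swapped is a split. -/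
lemma SepSplit.swap {side : Fin 5 → Bool} {VL VH : Set V} {F : Finset E} {z : Config E}
    (h : SepSplit ends mk σ side VL VH F z)
    (hsep : ∀ k, side k = false → ∀ i, σ i ≠ mk k) :
    SepSplit ends mk σ (fun k => !side k) VH VL F z where
  split := fun e he => (h.split e he).symm
  cap := fun t h1 h2 => h.cap t h2 h1
  noloop := fun e he hh => h.noloop e he ⟨hh.2, hh.1⟩
  rootH := fun k hk => h.farL k (by simpa using hk)
  farL := fun k hk => h.rootH k (by simpa using hk)
  farsep := fun k hk => hsep k (by simpa using hk)

/-- **The rule read from the other side**: with no mark on the separator, it suffices that the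
realised `S₃`-orbit sums of the glued counts of the side `VL` (the far-side data of `VH` frozen) be
nonnegative. -/
theorem typedCount_nonneg_of_sepSplit_realised_swap {side : Fin 5 → Bool} {VL VH : Set V}
    (F : Finset E) (z : Config E) (τ : E → ℕ) (hτ : ∀ e ∈ F, τ e = 1 ∨ τ e = 2)
    (h : SepSplit ends mk σ side VL VH F z) (hsep : ∀ k, side k = false → ∀ i, σ i ≠ mk k)
    (hroot : ∀ p : Pat3S ι,
      typedCount (sideF ends VH F) z τ
          (farKS ends mk σ VH p : Config E → Config E → Config E → R) ≠ 0 →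
      (0 : R) ≤ orbitRootS ends mk σ (fun k => !side k) VL (sideF ends VL F) z τ p) :
    0 ≤ typedCount F z τ
      (K3 ends (mk 0) (mk 1) (mk 2) (mk 3) (mk 4) : Config E → Config E → Config E → R) :=
  typedCount_nonneg_of_sepSplit_realised ends mk σ F z τ hτ (SepSplit.swap ends mk σ h hsep) hroot

/-- **The equality locus read from the other side.** -/
theorem typedCount_eq_zero_iff_of_sepSplit_swap {side : Fin 5 → Bool} {VL VH : Set V}
    (F : Finset E) (z : Config E) (τ : E → ℕ) (hτ : ∀ e ∈ F, τ e = 1 ∨ τ e = 2)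
    (h : SepSplit ends mk σ side VL VH F z) (hsep : ∀ k, side k = false → ∀ i, σ i ≠ mk k)
    (hroot : ∀ p : Pat3S ι,
      typedCount (sideF ends VH F) z τ
          (farKS ends mk σ VH p : Config E → Config E → Config E → R) ≠ 0 →
      (0 : R) ≤ orbitRootS ends mk σ (fun k => !side k) VL (sideF ends VL F) z τ p) :
    typedCount F z τ
        (K3 ends (mk 0) (mk 1) (mk 2) (mk 3) (mk 4) : Config E → Config E → Config E → R) = 0 ↔
      ∀ p : Pat3S ι,
        typedCount (sideF ends VH F) z τ
            (farKS ends mk σ VH p : Config E → Config E → Config E → R) ≠ 0 →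
          orbitRootS ends mk σ (fun k => !side k) VL (sideF ends VL F) z τ p = (0 : R) :=
  typedCount_eq_zero_iff_of_sepSplit ends mk σ F z τ hτ (SepSplit.swap ends mk σ h hsep) hroot

/-- **Either side suffices**: row 2′TRI at a split with no mark on the separator follows from the
realised orbit hypothesis on whichever side carries it. -/
theorem typedCount_nonneg_of_sepSplit_realised_either {side : Fin 5 → Bool} {VL VH : Set V}
    (F : Finset E) (z : Config E) (τ : E → ℕ) (hτ : ∀ e ∈ F, τ e = 1 ∨ τ e = 2)
    (h : SepSplit ends mk σ side VL VH F z) (hsep : ∀ k, side k = false → ∀ i, σ i ≠ mk k)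
    (hroot : (∀ p : Pat3S ι,
        typedCount (sideF ends VL F) z τ
            (farKS ends mk σ VL p : Config E → Config E → Config E → R) ≠ 0 →
        (0 : R) ≤ orbitRootS ends mk σ side VH (sideF ends VH F) z τ p) ∨
      (∀ p : Pat3S ι,
        typedCount (sideF ends VH F) z τ
            (farKS ends mk σ VH p : Config E → Config E → Config E → R) ≠ 0 →
        (0 : R) ≤ orbitRootS ends mk σ (fun k => !side k) VL (sideF ends VL F) z τ p)) :
    0 ≤ typedCount F z τ
      (K3 ends (mk 0) (mk 1) (mk 2) (mk 3) (mk 4) : Config E → Config E → Config E → R) := by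
  rcases hroot with hroot | hroot
  · exact typedCount_nonneg_of_sepSplit_realised ends mk σ F z τ hτ h hroot
  · exact typedCount_nonneg_of_sepSplit_realised_swap ends mk σ F z τ hτ h hsep hroot

end Swap

end RootBridge

end CovForm

end Summit.Ventures.PercRepro2
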